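import Mathlib
import HarnessLib

/-!
# Route `TautLoopKelvin`, crux `TautLoopLaw` (stmt-NavierStokesRegularity-15249),
  line `Sketch-ideas-r1k1` (Dini–Saks architecture) — stub `stub_tautLoopDiniSaks`

**Statement (pure real analysis).** Let `f : ℝ → [0,∞]`, `Λ Φ : ℝ → ℝ`, `a ≤ b`, `0 ≤ M`, with
`Φ` measurable, `Λ ≤ Φ` on `(a,b)` and `∫⁻_{(a,b)} Φ⁺ ≤ M`. Assume

* right-lower-semicontinuity on `[a,b)`: `f t ≤ liminf_{s ↓ t} f s`;
* the left-Dini step on `(a,b]`: for every `η > 0` and all small `h > 0`,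
  `f (t - h) ≤ f t · exp (h (Λ t + η))`.

Then `f a · e^{-M} ≤ f b`.

**Proof** (Saks-type backward real induction against a Vitali–Carathéodory majorant).
1. `tautLoopDiniSaks_majorant`: by the Vitali–Carathéodory theorem
   (`MeasureTheory.exists_lt_lowerSemicontinuous_integral_gt_nnreal`) there is a lower
   semicontinuous `Ψ : ℝ → [0,∞]` with `Φ⁺ < Ψ` on `(a,b)` and `∫ Ψ ≤ M + ε`; its primitive
   `J s := ∫_s^b Ψ` is continuous, nonnegative on `(-∞, b]`, `J a ≤ M + ε`, and, by lower
   semicontinuity of `Ψ`, `J s + h Φ s ≤ J (s - h)` for all small `h > 0` at every `s ∈ (a,b)`.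
2. `tautLoopDiniSaks_realInduction`: a set `S ⊆ [a,b]` containing `b`, containing every point of
   `[a,b)` at which it accumulates from the right, and containing a smaller point below each of
   its points in `(a,b]`, contains `a` (look at `inf S`).
3. `tautLoopDiniSaks_core`: apply 2 to `S := {s ∈ [a,b] : f s ≤ f b · exp (J s + η (b - s) + η)}`;
   closedness from the right is the right-lower-semicontinuity of `f` plus the continuity of `J`;
   the point to the left of an interior `s ∈ S` is `s - h` from the Dini step (with `η/2`) and 1,
   and at `s = b` (where `Λ b` is not controlled) from `J ≥ 0` and the extra slack `+η`.
4. Hence `f a ≤ f b · exp (M + ε + η (b - a) + η)` for all `ε, η > 0`; let `ε, η → 0`.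

References: S. Saks, *Theory of the Integral* (1937), Ch. VI §§4–5 (majorants and Dini
derivates); J. W. Hagood, B. S. Thomson, *Recovering a function from a Dini derivative*, Amer.
Math. Monthly 113 (2006); W. Rudin, *Real and Complex Analysis*, Thm. 2.25 (Vitali–Carathéodory);
the Mathlib model `image_le_of_liminf_slope_right_lt_deriv_boundary'`.
-/

noncomputable section

open Set MeasureTheory Filter Topology
open scoped ENNReal NNReal

namespace Summit.NavierStokesRegularity.NavierStokesRegularity.Theorems

set_option linter.dupNamespace false

/-- **Backward real induction.** If `S ⊆ [a,b]` contains `b`, contains every `s ∈ [a,b)` at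
which it accumulates from the right, and below each of its points in `(a,b]` contains a further
point, then `a ∈ S` (consider `inf S`). [folklore] -/
theorem tautLoopDiniSaks_realInduction {a b : ℝ} {S : Set ℝ} (hS : S ⊆ Icc a b) (hb : b ∈ S)
    (hclosed : ∀ s ∈ Ico a b, (∃ᶠ x in 𝓝[>] s, x ∈ S) → s ∈ S)
    (hopen : ∀ s ∈ Ioc a b, s ∈ S → ∃ s' ∈ S, s' < s) : a ∈ S := by
  have hne : S.Nonempty := ⟨b, hb⟩
  have hbdd : BddBelow S := ⟨a, fun x hx => (hS hx).1⟩
  have ha₀ : a ≤ sInf S := le_csInf hne fun x hx => (hS hx).1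
  have h₀b : sInf S ≤ b := csInf_le hbdd hb
  have hmem : sInf S ∈ S := by
    by_contra hnot
    have hlt : sInf S < b := lt_of_le_of_ne h₀b fun h => hnot (h ▸ hb)
    have hfreq : ∃ᶠ x in 𝓝[≥] sInf S, x ∈ S := (isGLB_csInf hne hbdd).frequently_mem hne
    rw [← Ioi_insert, nhdsWithin_insert, frequently_sup, frequently_pure] at hfreq
    rcases hfreq with h | h
    · exact hnot h
    · exact hnot (hclosed _ ⟨ha₀, hlt⟩ h)
  have hs₀a : sInf S = a := by
    by_contra hne'
    obtain ⟨s', hs', hs'lt⟩ := hopen _ ⟨lt_of_le_of_ne ha₀ (Ne.symm hne'), h₀b⟩ hmem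
    exact absurd (csInf_le hbdd hs') (not_le.2 hs'lt)
  exact hs₀a ▸ hmem

/-- **Vitali–Carathéodory majorant and its primitive.** If `Φ` is measurable with
`∫⁻_{(a,b)} Φ⁺ ≤ M` (`0 ≤ M`, `a ≤ b`) and `ε > 0`, there is `J : ℝ → ℝ` (the primitive
`s ↦ ∫_s^b Ψ` of a lower semicontinuous, a.e. finite, integrable `Ψ > Φ⁺` on `(a,b)`),
continuous on `[a,b]`, nonnegative on `(-∞, b]`, with `J a ≤ M + ε` and
`J s + h · Φ s ≤ J (s - h)` for all small `h > 0` at every `s ∈ (a,b)` (Vitali–Carathéodory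
theorem, W. Rudin, *Real and Complex Analysis*, Thm. 2.25). [folklore] -/
theorem tautLoopDiniSaks_majorant {Φ : ℝ → ℝ} {a b M ε : ℝ} (hab : a ≤ b) (hM : 0 ≤ M)
    (hΦ : Measurable Φ) (hint : (∫⁻ s in Ioo a b, ENNReal.ofReal (Φ s)) ≤ ENNReal.ofReal M)
    (hε : 0 < ε) :
    ∃ J : ℝ → ℝ, ContinuousOn J (Icc a b) ∧ (∀ s, s ≤ b → 0 ≤ J s) ∧ J a ≤ M + ε ∧
      ∀ s ∈ Ioo a b, ∀ᶠ h in 𝓝[>] (0:ℝ), J s + h * Φ s ≤ J (s - h) := by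
  -- the nonnegative part of `Φ`, cut off outside `(a,b)`
  set φ : ℝ → ℝ≥0 := (Ioo a b).indicator fun x => (Φ x).toNNReal with hφ_def
  have hφm : Measurable φ := hΦ.real_toNNReal.indicator measurableSet_Ioo
  have hlin : (∫⁻ x, (φ x : ℝ≥0∞)) = ∫⁻ x in Ioo a b, ENNReal.ofReal (Φ x) := by
    rw [← lintegral_indicator measurableSet_Ioo]
    congr 1 with x
    rw [hφ_def, ENNReal.coe_indicator]
    rfl
  have hlin_lt : (∫⁻ x, (φ x : ℝ≥0∞)) < ∞ := by
    rw [hlin]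
    exact hint.trans_lt ENNReal.ofReal_lt_top
  have hφi : Integrable (fun x => (φ x : ℝ)) volume :=
    ⟨hφm.coe_nnreal_real.aestronglyMeasurable, hasFiniteIntegral_iff_ofNNReal.2 hlin_lt⟩
  obtain ⟨g, hg_lt, hg_lsc, hg_fin, hg_int, hg_integral⟩ :=
    exists_lt_lowerSemicontinuous_integral_gt_nnreal φ hφi hε
  -- the integral of `φ` is at most `M`
  have hφ_integral : (∫ x, (φ x : ℝ)) ≤ M := by
    rw [integral_eq_lintegral_of_nonneg_ae (Eventually.of_forall fun x => NNReal.coe_nonneg _)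
      hφi.aestronglyMeasurable]
    simp only [ENNReal.ofReal_coe_nnreal]
    rw [hlin]
    exact ENNReal.toReal_le_of_le_ofReal hM hint
  refine ⟨fun s => ∫ x in s..b, (g x).toReal, ?_, ?_, ?_, ?_⟩
  · exact (intervalIntegral.continuousOn_primitive_interval_left
      hg_int.integrableOn).mono Icc_subset_uIcc
  · intro s hs
    exact intervalIntegral.integral_nonneg hs fun x _ => ENNReal.toReal_nonneg
  · calc (∫ x in a..b, (g x).toReal)
        = ∫ x in Ioc a b, (g x).toReal := intervalIntegral.integral_of_le hab
      _ ≤ ∫ x, (g x).toReal :=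
          setIntegral_le_integral hg_int (Eventually.of_forall fun x => ENNReal.toReal_nonneg)
      _ ≤ M + ε := by linarith [hg_integral, hφ_integral]
  · intro s hs
    have h1 : ((Φ s).toNNReal : ℝ≥0∞) < g s := by
      have := hg_lt s
      rwa [hφ_def, indicator_of_mem hs] at this
    obtain ⟨δ, hδ, hball⟩ := Metric.eventually_nhds_iff.1 (hg_lsc s _ h1)
    have hpos : 0 < min δ (s - a) := lt_min hδ (sub_pos.2 hs.1)
    filter_upwards [Ioo_mem_nhdsGT hpos] with h hh
    have hh0 : 0 < h := hh.1
    have hhδ : h < δ := hh.2.trans_le (min_le_left _ _)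
    have hI1 : IntervalIntegrable (fun x => (g x).toReal) volume (s - h) s :=
      hg_int.intervalIntegrable
    have hI2 : IntervalIntegrable (fun x => (g x).toReal) volume s b := hg_int.intervalIntegrable
    have hmono : (∫ _ in (s - h)..s, Φ s) ≤ ∫ x in (s - h)..s, (g x).toReal := by
      refine intervalIntegral.integral_mono_ae_restrict (by linarith) intervalIntegrable_const
        hI1 ?_
      filter_upwards [ae_restrict_of_ae (s := Icc (s - h) s) hg_fin,
        ae_restrict_mem measurableSet_Icc] with x hx hxI
      have hdist : dist x s < δ := by
        rw [Real.dist_eq, abs_sub_comm, abs_of_nonneg (by linarith [hxI.2])]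
        linarith [hxI.1]
      calc Φ s ≤ ((Φ s).toNNReal : ℝ) := Real.le_coe_toNNReal _
        _ = (((Φ s).toNNReal : ℝ≥0∞)).toReal := by simp
        _ ≤ (g x).toReal := ENNReal.toReal_mono hx.ne (hball hdist).le
    rw [intervalIntegral.integral_const, smul_eq_mul, show s - (s - h) = h by ring] at hmono
    have hsplit := intervalIntegral.integral_add_adjacent_intervals hI1 hI2
    show (∫ x in s..b, (g x).toReal) + h * Φ s ≤ ∫ x in (s - h)..b, (g x).toReal
    rw [← hsplit]
    linarith

/-- **The backward induction for a fixed majorant.** With `J` as in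
`tautLoopDiniSaks_majorant` (continuous on `[a,b]`, nonnegative on `(-∞,b]`,
`J s + h Λ s ≤ J (s - h)` for small `h > 0` at interior points), right-lower-semicontinuity of `f`
on `[a,b)` and the left-Dini step on `(a,b]` give `f a ≤ f b · exp (J a + η (b - a) + η)` for
every `η > 0`. [folklore] -/
theorem tautLoopDiniSaks_core {f : ℝ → ℝ≥0∞} {Λ J : ℝ → ℝ} {a b η : ℝ} (hab : a ≤ b)
    (hη : 0 < η) (hJc : ContinuousOn J (Icc a b)) (hJ0 : ∀ s, s ≤ b → 0 ≤ J s)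
    (hJΛ : ∀ s ∈ Ioo a b, ∀ᶠ h in 𝓝[>] (0:ℝ), J s + h * Λ s ≤ J (s - h))
    (hlsc : ∀ t ∈ Ico a b, f t ≤ liminf f (𝓝[>] t))
    (hstep : ∀ t ∈ Ioc a b, ∀ η : ℝ, 0 < η → ∀ᶠ h in 𝓝[>] (0:ℝ),
      f (t - h) ≤ f t * ENNReal.ofReal (Real.exp (h * (Λ t + η)))) :
    f a ≤ f b * ENNReal.ofReal (Real.exp (J a + η * (b - a) + η)) := by
  -- the comparison function and the good set
  set E : ℝ → ℝ≥0∞ := fun s => f b * ENNReal.ofReal (Real.exp (J s + η * (b - s) + η)) with hE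
  set S : Set ℝ := {s | s ∈ Icc a b ∧ f s ≤ E s} with hS
  suffices hmain : a ∈ S from hmain.2
  refine tautLoopDiniSaks_realInduction (S := S) (fun x hx => hx.1) ?_ ?_ ?_
  · -- `b ∈ S`
    refine ⟨right_mem_Icc.2 hab, le_mul_of_one_le_right' ?_⟩
    refine ENNReal.one_le_ofReal.2 (Real.one_le_exp ?_)
    have := hJ0 b le_rfl
    linarith
  · -- `S` is closed under accumulation from the right
    intro s hs hfreq
    refine ⟨⟨hs.1, hs.2.le⟩, ?_⟩
    have hJt : Tendsto J (𝓝[>] s) (𝓝 (J s)) :=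
      (hJc s ⟨hs.1, hs.2.le⟩).mono_of_mem_nhdsWithin (Icc_mem_nhdsGT_of_mem hs)
    have hEt : Tendsto E (𝓝[>] s) (𝓝 (E s)) := by
      have h3 : Tendsto (fun x => J x + η * (b - x) + η) (𝓝[>] s)
          (𝓝 (J s + η * (b - s) + η)) := by
        have hc : Continuous fun x : ℝ => η * (b - x) + η := by fun_prop
        have := hJt.add ((hc.tendsto s).mono_left nhdsWithin_le_nhds)
        simpa only [add_assoc] using this
      have h4 := (ENNReal.continuous_ofReal.tendsto _).comp
        ((Real.continuous_exp.tendsto _).comp h3)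
      exact ENNReal.Tendsto.const_mul h4 (Or.inl (ENNReal.ofReal_pos.2 (Real.exp_pos _)).ne')
    refine le_of_forall_lt_imp_le_of_dense fun y hy => ?_
    have hev : ∀ᶠ x in 𝓝[>] s, y < f x := eventually_lt_of_lt_liminf (hy.trans_le (hlsc s hs))
    exact ge_of_tendsto_of_frequently hEt
      ((hfreq.and_eventually hev).mono fun x hx => hx.2.le.trans hx.1.2)
  · -- below each point of `S ∩ (a,b]` there is a further point of `S`
    intro s hs hsS
    have hsa : 0 < s - a := sub_pos.2 hs.1
    have hst := hstep s hs (η / 2) (half_pos hη)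
    have hclaim : ∀ᶠ h in 𝓝[>] (0:ℝ), f (s - h) ≤ E (s - h) := by
      rcases hs.2.lt_or_eq with hsb | hsb
      · filter_upwards [hst, hJΛ s ⟨hs.1, hsb⟩, self_mem_nhdsWithin] with h h1 h2 h0
        have h0' : 0 < h := h0
        calc f (s - h) ≤ f s * ENNReal.ofReal (Real.exp (h * (Λ s + η / 2))) := h1
          _ ≤ E s * ENNReal.ofReal (Real.exp (h * (Λ s + η / 2))) := mul_le_mul_left hsS.2 _
          _ = f b * ENNReal.ofReal (Real.exp ((J s + η * (b - s) + η) + h * (Λ s + η / 2))) := by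
              rw [Real.exp_add, ENNReal.ofReal_mul (Real.exp_pos _).le, hE, mul_assoc]
          _ ≤ E (s - h) :=
              mul_le_mul_right (ENNReal.ofReal_le_ofReal (Real.exp_le_exp.2
                (by nlinarith [mul_pos h0' hη]))) _
      · have hsmall : ∀ᶠ h in 𝓝[>] (0:ℝ), h * Λ s ≤ η := by
          have hc : Continuous fun h : ℝ => h * Λ s := by fun_prop
          have ht : Tendsto (fun h : ℝ => h * Λ s) (𝓝[>] 0) (𝓝 0) := by
            simpa using (hc.tendsto 0).mono_left nhdsWithin_le_nhds
          exact ht.eventually (eventually_le_nhds hη)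
        filter_upwards [hst, hsmall, self_mem_nhdsWithin] with h h1 h2 h0
        have h0' : 0 < h := h0
        have hJ := hJ0 (s - h) (by linarith [hs.2])
        rw [hE]
        dsimp only
        rw [← hsb]
        calc f (s - h) ≤ f s * ENNReal.ofReal (Real.exp (h * (Λ s + η / 2))) := h1
          _ ≤ f s * ENNReal.ofReal (Real.exp (J (s - h) + η * (s - (s - h)) + η)) :=
              mul_le_mul_right (ENNReal.ofReal_le_ofReal (Real.exp_le_exp.2
                (by nlinarith [mul_pos h0' hη]))) _
    obtain ⟨h, hh, hpos, hlt⟩ : ∃ h, f (s - h) ≤ E (s - h) ∧ 0 < h ∧ h < s - a :=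
      (hclaim.and (Ioo_mem_nhdsGT hsa)).exists
    exact ⟨s - h, ⟨⟨by linarith, by linarith [hs.2]⟩, hh⟩, by linarith⟩

/-- **Dini–Saks transfer** (stub `stub_tautLoopDiniSaks` of line `Sketch-ideas-r1k1` for the crux
`TautLoopLaw`). A Saks-type monotonicity lemma in `[0,∞]`: right-lower-semicontinuity on `[a,b)`
plus an exact left-Dini step at every point of `(a,b]` against a rate `Λ` with a measurable
majorant `Φ ≥ Λ` on `(a,b)`, `∫⁻_{(a,b)} Φ⁺ ≤ M`, give `f(a)·e^{-M} ≤ f(b)` (S. Saks, *Theory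
of the Integral* (1937), Ch. VI §§4–5; J. W. Hagood, B. S. Thomson, Amer. Math. Monthly 113
(2006)). [folklore] -/
theorem stub_tautLoopDiniSaks : ∀ (f : ℝ → ENNReal) (Λ Φ : ℝ → ℝ) (a b M : ℝ), a ≤ b → 0 ≤ M →
    Measurable Φ → (∀ s ∈ Set.Ioo a b, Λ s ≤ Φ s) →
    (∫⁻ s in Set.Ioo a b, ENNReal.ofReal (Φ s)) ≤ ENNReal.ofReal M →
    (∀ t ∈ Set.Ico a b, f t ≤ Filter.liminf f (nhdsWithin t (Set.Ioi t))) →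
    (∀ t ∈ Set.Ioc a b, ∀ η : ℝ, 0 < η → ∀ᶠ h in nhdsWithin (0:ℝ) (Set.Ioi 0),
      f (t - h) ≤ f t * ENNReal.ofReal (Real.exp (h * (Λ t + η)))) →
    f a * ENNReal.ofReal (Real.exp (-M)) ≤ f b := by
  intro f Λ Φ a b M hab hM hΦ hmaj hint hlsc hstep
  -- Step 1: `f a ≤ f b · exp (M + δ)` for every `δ > 0`
  have hδ : ∀ δ : ℝ, 0 < δ → f a ≤ f b * ENNReal.ofReal (Real.exp (M + δ)) := by
    intro δ hδ
    have hba : 0 < b - a + 1 := by linarith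
    set η : ℝ := δ / (3 * (b - a + 1)) with hη
    have hηpos : 0 < η := div_pos hδ (by positivity)
    have hηeq : η * (b - a) + η = δ / 3 := by
      rw [hη]
      field_simp
    obtain ⟨J, hJc, hJ0, hJa, hJΦ⟩ :=
      tautLoopDiniSaks_majorant hab hM hΦ hint (by positivity : (0:ℝ) < δ / 3)
    have hJΛ : ∀ s ∈ Ioo a b, ∀ᶠ h in 𝓝[>] (0:ℝ), J s + h * Λ s ≤ J (s - h) := by
      intro s hs
      filter_upwards [hJΦ s hs, self_mem_nhdsWithin] with h h1 h2
      have h2' : 0 < h := h2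
      have := mul_le_mul_of_nonneg_left (hmaj s hs) h2'.le
      linarith
    calc f a ≤ f b * ENNReal.ofReal (Real.exp (J a + η * (b - a) + η)) :=
          tautLoopDiniSaks_core hab hηpos hJc hJ0 hJΛ hlsc hstep
      _ ≤ f b * ENNReal.ofReal (Real.exp (M + δ)) :=
          mul_le_mul_right (ENNReal.ofReal_le_ofReal (Real.exp_le_exp.2 (by linarith))) _
  -- Step 2: move `e^{-M}` to the left
  have hδ' : ∀ δ : ℝ, 0 < δ →
      f a * ENNReal.ofReal (Real.exp (-M)) ≤ f b * ENNReal.ofReal (Real.exp δ) := by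
    intro δ hδ0
    calc f a * ENNReal.ofReal (Real.exp (-M))
        ≤ f b * ENNReal.ofReal (Real.exp (M + δ)) * ENNReal.ofReal (Real.exp (-M)) :=
          mul_le_mul_left (hδ δ hδ0) _
      _ = f b * ENNReal.ofReal (Real.exp δ) := by
          rw [mul_assoc, ← ENNReal.ofReal_mul (Real.exp_pos _).le, ← Real.exp_add,
            show M + δ + -M = δ by ring]
  -- Step 3: let `δ → 0⁺`
  have ht : Tendsto (fun δ : ℝ => f b * ENNReal.ofReal (Real.exp δ)) (𝓝[>] 0) (𝓝 (f b)) := by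
    have h1 : Tendsto (fun δ : ℝ => ENNReal.ofReal (Real.exp δ)) (𝓝[>] 0) (𝓝 1) := by
      have h0 : Tendsto (fun δ : ℝ => ENNReal.ofReal (Real.exp δ)) (𝓝[>] 0)
          (𝓝 (ENNReal.ofReal (Real.exp 0))) :=
        ((ENNReal.continuous_ofReal.comp Real.continuous_exp).tendsto (0:ℝ)).mono_left
          nhdsWithin_le_nhds
      simpa using h0
    simpa using ENNReal.Tendsto.const_mul h1 (Or.inl one_ne_zero)
  exact ge_of_tendsto ht (by filter_upwards [self_mem_nhdsWithin] with δ hδ0 using hδ' δ hδ0)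

end Summit.NavierStokesRegularity.NavierStokesRegularity.Theorems

end
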